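import Summits.ABC.ABC.Theses.PadicPrimesKummerThird
import Summits.ABC.StewartYu.GenThreeOfPadicClause
import HarnessLib

/-!
# Route `PadicPrimesKummerThird`: the crux statements BY NAME from the named fact of record
# (T1 dossier, by-name form; to be filed by a PROVER under `Summits/ABC/ABC/Theorems/` with
# `--supports stmt-ABC-19658` — lit seats cannot write to `Theorems/`)

`Y07Odd` (stmt-ABC-19658) and `Y07Two` (stmt-ABC-19659), as declared in
`Summits/ABC/ABC/Theses/PadicPrimesKummerThird.lean`, follow from
`Literature.Barriers.ABC.yu2007_padicLogForm_rat` (Yu 2007 over `ℚ`, Evertse–Győry Thm 3.2.7) —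
by-name restatements of `Summit.ABC.StewartYu.Y07.y07Odd_of_yu2007` / `y07Two_of_yu2007`
(p448111), whose conclusions are these texts verbatim. Nothing is closed: the fact is unproved in the
tree; the route's content is proving the cruxes WITHOUT it.
-/

set_option linter.dupNamespace false

namespace Summit.ABC.ABC.Theorems

open Summit.ABC.ABC.Theses.PadicPrimesKummerThird

/-- `Y07Odd` from Yu's theorem over `ℚ` (by name). [cite: EvertseGyory2015, Thm 3.2.7 (p. 62)] -/
theorem padicPrimesKummerThird_y07Odd_of_yu2007
    (h : Literature.Barriers.ABC.yu2007_padicLogForm_rat) : Y07Odd :=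
  Summit.ABC.StewartYu.Y07.y07Odd_of_yu2007 h

/-- `Y07Two` from Yu's theorem over `ℚ` (by name). [cite: EvertseGyory2015, Thm 3.2.7 (p. 62)] -/
theorem padicPrimesKummerThird_y07Two_of_yu2007
    (h : Literature.Barriers.ABC.yu2007_padicLogForm_rat) : Y07Two :=
  Summit.ABC.StewartYu.Y07.y07Two_of_yu2007 h

/-- Both cruxes from Pasten's `p`-adic clause (ii) over `ℚ` with any constant `K ≥ 1` (by name).
[cite: Pasten2024, Thm 2.1 (ii)] -/
theorem padicPrimesKummerThird_y07_of_padicClause {K : ℝ} (hK : 1 ≤ K)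
    (hP2 : ∀ (ι : Type) [Fintype ι], 0 < Fintype.card ι →
      ∀ ξ : ι → ℚ, (∀ i, ξ i ≠ 0 ∧ ξ i ≠ 1 ∧ ξ i ≠ -1) →
      ∀ ζ : ℚ, (ζ = 1 ∨ ζ = -1) → ∀ b : ι → ℤ, ζ * ∏ i, ξ i ^ b i ≠ 1 →
      ∀ p : ℕ, p.Prime →
        (padicValRat p (1 - ζ * ∏ i, ξ i ^ b i) : ℝ) * Real.log p <
          K ^ Fintype.card ι * (p / Real.log p) *
            Real.log (max (Real.exp 1) (p * Height.logHeight₁ (ζ * ∏ i, ξ i ^ b i))) *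
            ∏ i, Height.logHeight₁ (ξ i)) :
    Y07Odd ∧ Y07Two :=
  ⟨Summit.ABC.StewartYu.Y07.y07Odd_of_padicClause hK hP2,
   Summit.ABC.StewartYu.Y07.y07Two_of_padicClause hK hP2⟩

end Summit.ABC.ABC.Theorems
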